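import Mathlib
import Literature.AlgebraicGeometry.Motives.AbelianVariety

/-!
# Crux-triage check (refuter, stmt-HodgeConjecture-14874): the `CyclotomicCMTransfer` hypothesis of card
`jacobian-anchor-transfer` only covers abelian varieties of dimension `≤ m/2`

`IsCyclotomicCM m A` (ideator 2, `Cruxes/FermatAnchorAssembly/IdeatorTwoSketch.md`, copied verbatim below) asks
for ONE endomorphism `φ` with `φ ^ m = 1` generating a `ℚ`-subalgebra of `End⁰(A)` of dimension `2 · dim A`.
Since `φ` is a root of `X ^ m - 1`, that subalgebra is spanned by `1, φ, …, φ^{m-1}`, so `2 · dim A ≤ m`: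
no product host `A_s` of Fermat–Jacobian factors with `2 · dim A_s > m` (e.g. da Silva's `m = 33` host,
`dim A_s = 35`) satisfies the hypothesis, and the transfer as typed never routes the residual sign classes
through their hosts.
-/

set_option linter.dupNamespace false

open Literature.AlgebraicGeometry.Motives CategoryTheory

namespace Summit.HodgeConjecture.HodgeConjecture.Cruxes.FermatAnchorAssembly.Triage

/-- In any (possibly non-commutative) `ℚ`-algebra, an element with `x ^ m = 1`, `m ≥ 1`, generates a
subalgebra of `ℚ`-dimension at most `m`. [folklore] -/
theorem finrank_adjoin_le_of_pow_eq_one {R : Type*} [Ring R] [Algebra ℚ R] (x : R) {m : ℕ}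
    (hm : 1 ≤ m) (hx : x ^ m = 1) :
    Module.finrank ℚ (Algebra.adjoin ℚ ({x} : Set R)) ≤ m := by
  classical
  have hspan : Subalgebra.toSubmodule (Algebra.adjoin ℚ ({x} : Set R)) ≤
      Submodule.span ℚ (((Finset.range m).image fun i => x ^ i : Finset R) : Set R) := by
    rw [Algebra.adjoin_eq_span]
    refine Submodule.span_le.2 ?_
    intro y hy
    have hy' : y ∈ Submonoid.powers x := by
      rw [Submonoid.powers_eq_closure]; exact hy
    obtain ⟨i, rfl⟩ := hy'
    apply Submodule.subset_span
    simp only [Finset.coe_image, Finset.coe_range, Set.mem_image, Set.mem_Iio]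
    refine ⟨i % m, Nat.mod_lt _ hm, ?_⟩
    conv_rhs => rw [← Nat.div_add_mod i m, pow_add, pow_mul, hx, one_pow, one_mul]
  calc Module.finrank ℚ (Algebra.adjoin ℚ ({x} : Set R))
      = Module.finrank ℚ (Subalgebra.toSubmodule (Algebra.adjoin ℚ ({x} : Set R))) :=
        (Subalgebra.finrank_toSubmodule _).symm
    _ ≤ Module.finrank ℚ
          (Submodule.span ℚ (((Finset.range m).image fun i => x ^ i : Finset R) : Set R)) :=
        Submodule.finrank_mono hspan
    _ ≤ ((Finset.range m).image fun i => x ^ i).card := finrank_span_finset_le_card _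
    _ ≤ m := by simpa using (Finset.card_image_le (s := Finset.range m) (f := fun i => x ^ i))

/-- Verbatim copy of ideator 2's `IsCyclotomicCM` (IdeatorTwoSketch.md, card jacobian-anchor-transfer): a PREDICATE on
`(m, A)`, not a closed fact. -/
def IsCyclotomicCM (m : ℕ) (A : AbelianVariety ℂ) : Prop :=
  ∃ φ : End A, φ ^ m = 1 ∧
    Module.finrank ℚ (Algebra.adjoin ℚ ({AbelianVariety.endAlgebra.of A φ} : Set (AbelianVariety.endAlgebra A)))
      = 2 * A.dim

/-- **The hypothesis of `CyclotomicCMTransfer` only ever speaks about abelian varieties of dimension `≤ m / 2`.**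
[folklore] -/
theorem two_mul_dim_le_of_isCyclotomicCM {m : ℕ} {A : AbelianVariety ℂ} (hm : 1 ≤ m)
    (h : IsCyclotomicCM m A) : 2 * A.dim ≤ m := by
  obtain ⟨φ, hφ, hdim⟩ := h
  rw [← hdim]
  exact finrank_adjoin_le_of_pow_eq_one _ hm (by rw [← map_pow, hφ, map_one])

/-- Numerical instance: da Silva's `m = 33` host has `dim A_s = 10 + 10 + 5 + 10 = 35`, and `2 · 35 > 33`. -/
example : ¬ (2 * 35 ≤ 33) := by decide

end Summit.HodgeConjecture.HodgeConjecture.Cruxes.FermatAnchorAssembly.Triage
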